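import Summits.ResolutionOfSingularities.ResolutionOfSingularities.Theorems.EquisingularLiftCampaignW45bStrictTransformMultiplicity
import Summits.ResolutionOfSingularities.ResolutionOfSingularities.Theorems.EquisingularLiftCampaignW45bUniqueBadPoint
import Mathlib.FieldTheory.IsAlgClosed.Basic
import Mathlib.RingTheory.UniqueFactorizationDomain.Ideal
import Mathlib.RingTheory.Localization.LocalizationLocalization
import HarnessLib

/-!
# [OURS · L1 W4.5(b)] The bad point is the ONLY non-regular point of the blow-up of `V(e, w)` over the closed point (all primes, residue field algebraically closed)

Crux chain w45b, working crux EL♮ = `Theses.EquisingularLift.EquisingularLiftNat` (stmt-ResolutionOfSingularities-20038), stub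
`stub_elnat_three_isolated`; completion of helper L2 «UNIQUE BAD POINT» (CRUX-PLAN v1.1 §3.4, res-L1-w45b-plan-1): the rational
point statements of `…CampaignW45bUniqueBadPoint` (p504070) upgraded to ALL primes of both charts over the closed point, when the
residue field is algebraically closed (the case of the programme: `k = k̄`). OURS; NOT a statement of any manuscript; AI-written,
weaker than expert review. `--supports stmt-ResolutionOfSingularities-20038 --as helper`.

SETTING: `R` regular local with ALGEBRAICALLY CLOSED residue field `k`, `e ∈ 𝔪 ∖ 𝔪²`, `w ∈ 𝔪²`, `w ∉ (e)`, `Z = V(e, w)`; charts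
`B = R[Z/e]` (`t = w/e`) and `B′ = R[Z/w]` (`u = e/w`) of `Bl_Z`. The primes of a chart over the closed point correspond, under the
reduction map onto the exceptional line `k[X]` (p504673 `exists_ringHom_polynomial_residueField`), to the primes of `k[X]`, i.e.
(`k = k̄`) to `⊥` and the `(X − c̄)`:

* `exists_X_sub_C_mem_of_ne_bot` — a non-zero prime of `k[X]`, `k` algebraically closed, contains some `X − C a`;
* `mem_or_eq_of_map_maximalIdeal_le` — CLASSIFICATION: a prime `𝔔 ⊇ 𝔪·R[I/a]` of a chart (`I = (a, b)`) contains `b/a − c` for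
  some `c ∈ R`, or IS the generic point `𝔪·R[I/a]` of the exceptional line;
* `point_isMaximal_of_eq` — the rational points `𝔪·R[I/a] + (b/a − c)` are maximal ideals (generic-pair form of p504673);
* `isRegularLocalRing_localization_of_le` — regularity descends from a point to every prime below it (Serre: localizations of
  regular local rings are regular);
* **`isRegularLocalRing_localization_eChart_iff`** — for every prime `𝔔 ⊇ 𝔪B` of the `e`-chart: `B_𝔔` is regular iff `w/e ∉ 𝔔`;
* **`isRegularLocalRing_localization_wChart'`** — every prime `𝔔 ⊇ 𝔪B′` of the `w`-chart has `B′_𝔔` regular.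
Hence the bad point `𝔓₀ = 𝔪B + (w/e)` is the UNIQUE non-regular point of `Bl_Z` over the closed point; the scheme-level reading
(via the dictionary p506193) is `…CampaignW45bBadPointCriterion`.

References: res-L1-w45b-plan-1 CRUX-PLAN v1.1 §3.4 L2 (OURS); H. Matsumura, *Commutative Ring Theory*, Thm. 14.2, 19.3 — context.
-/

noncomputable section

set_option linter.dupNamespace false -- mandated namespace `Summit.<Summit>.<Problem>` of this single-conjunct summit

open IsLocalRing IsLocalization Polynomial
open Literature.AlgebraicGeometry.Resolution

namespace Summit.ResolutionOfSingularities.ResolutionOfSingularities.Cruxes.EquisingularLiftNat.Sections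

universe u

/-! ## Primes of `k[X]`, `k` algebraically closed -/

/-- A non-zero prime ideal of `k[X]`, `k` algebraically closed, contains a linear polynomial `X − a`. [folklore] -/
theorem exists_X_sub_C_mem_of_ne_bot {k : Type u} [Field k] [IsAlgClosed k] (𝔮 : Ideal k[X]) [h𝔮 : 𝔮.IsPrime]
    (h : 𝔮 ≠ ⊥) : ∃ a : k, X - C a ∈ 𝔮 := by
  obtain ⟨p, hp𝔮, hp⟩ := Ideal.IsPrime.exists_mem_prime_of_ne_bot h𝔮 h
  have hdeg : p.degree = 1 := IsAlgClosed.degree_eq_one_of_irreducible k hp.irreducible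
  have hp1 : p = C p.leadingCoeff * X + C (p.coeff 0) := eq_X_add_C_of_degree_eq_one hdeg
  have hc1 : p.leadingCoeff ≠ 0 := leadingCoeff_ne_zero.mpr hp.ne_zero
  have hfac : p = C p.leadingCoeff * (X - C (-(p.coeff 0 / p.leadingCoeff))) := by
    conv_lhs => rw [hp1]
    rw [map_neg, sub_neg_eq_add, mul_add, ← C_mul, mul_div_cancel₀ _ hc1]
  rw [hfac] at hp𝔮
  rcases h𝔮.mem_or_mem hp𝔮 with hC | hX
  · exact absurd (𝔮.eq_top_of_isUnit_mem hC ((isUnit_C.mpr (isUnit_iff_ne_zero.mpr hc1)))) h𝔮.ne_top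
  · exact ⟨_, hX⟩

/-! ## The primes of a chart over the closed point -/

section Chart

variable {R : Type u} [CommRing R] [IsLocalRing R] [IsDomain R] {a b : R}

omit [IsDomain R] in
/-- Polynomials with coefficients in `𝔪` go to `𝔪·R[I/a]` under `X ↦ b/a`. [folklore] -/
theorem aeval_mem_map_of_map_residue_eq_zero (I : Ideal R) (hb : b ∈ I) {p : R[X]} (hp : p.map (residue R) = 0) :
    Polynomial.aeval (blowupAlgebra.gen I a b hb) p ∈ (maximalIdeal R).map (algebraMap R (blowupAlgebra I a)) := by
  have hp' : p ∈ (maximalIdeal R).map (C : R →+* R[X]) := by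
    rw [← ker_residue, ← Polynomial.ker_mapRingHom, RingHom.mem_ker, Polynomial.coe_mapRingHom, hp]
  have h := Ideal.mem_map_of_mem (Polynomial.aeval (blowupAlgebra.gen I a b hb)).toRingHom hp'
  rw [Ideal.map_map] at h
  have hcomp : (Polynomial.aeval (R := R) (blowupAlgebra.gen I a b hb)).toRingHom.comp C =
      algebraMap R (blowupAlgebra I a) := by
    ext r
    simp
  rwa [hcomp] at h

variable [IsAlgClosed (ResidueField R)]

/-- **CLASSIFICATION of the primes of a chart over the closed point** (`I = (a, b)`, `R` a local domain with algebraically closed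
residue field, `a, b ∈ 𝔪`, `a ≠ 0`, `a ∣ bx ⇒ a ∣ x`): a prime `𝔔 ⊇ 𝔪·R[I/a]` either contains `b/a − c` for some `c ∈ R` (a RATIONAL
point of the exceptional line `Spec k[X]`) or equals `𝔪·R[I/a]` (its generic point). [folklore] -/
theorem mem_or_eq_of_map_maximalIdeal_le (I : Ideal R) (hI : I = Ideal.span {a, b}) (hb : b ∈ I)
    (ha : a ∈ maximalIdeal R) (hbm : b ∈ maximalIdeal R) (ha0 : a ≠ 0) (hab : ∀ x : R, a ∣ b * x → a ∣ x)
    (𝔔 : Ideal (blowupAlgebra I a)) [𝔔.IsPrime] (hm : (maximalIdeal R).map (algebraMap R (blowupAlgebra I a)) ≤ 𝔔) :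
    (∃ c : R, blowupAlgebra.gen I a b hb - algebraMap R (blowupAlgebra I a) c ∈ 𝔔) ∨
      𝔔 = (maximalIdeal R).map (algebraMap R (blowupAlgebra I a)) := by
  set t := blowupAlgebra.gen I a b hb
  obtain ⟨ρ, hρ⟩ := exists_ringHom_polynomial_residueField I hI hb ha hbm ha0 hab
  have hsurjt := aeval_gen_surjective_of_eq I hI hb
  -- `ρ` is surjective with kernel inside `𝔪·R[I/a]`
  have hsurj : Function.Surjective ρ := by
    intro q
    obtain ⟨p, rfl⟩ := Polynomial.map_surjective (residue R) residue_surjective q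
    exact ⟨Polynomial.aeval t p, hρ p⟩
  have hker : RingHom.ker ρ ≤ (maximalIdeal R).map (algebraMap R (blowupAlgebra I a)) := by
    intro z hz
    obtain ⟨p, rfl⟩ := hsurjt z
    rw [RingHom.mem_ker, hρ] at hz
    exact aeval_mem_map_of_map_residue_eq_zero I hb hz
  have hker𝔔 : RingHom.ker ρ ≤ 𝔔 := hker.trans hm
  haveI : (𝔔.map ρ).IsPrime := Ideal.map_isPrime_of_surjective hsurj hker𝔔
  have hcomap : (𝔔.map ρ).comap ρ = 𝔔 := by
    rw [Ideal.comap_map_of_surjective _ hsurj, ← RingHom.ker_eq_comap_bot, sup_eq_left.mpr hker𝔔]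
  by_cases hbot : 𝔔.map ρ = ⊥
  · right
    refine le_antisymm ?_ hm
    rw [← hcomap, hbot, ← RingHom.ker_eq_comap_bot]
    exact hker
  · left
    obtain ⟨a', ha'⟩ := exists_X_sub_C_mem_of_ne_bot (𝔔.map ρ) hbot
    obtain ⟨c, rfl⟩ := residue_surjective a'
    refine ⟨c, ?_⟩
    rw [← hcomap, Ideal.mem_comap, map_sub, ← Polynomial.aeval_X (R := R) t, hρ, ← Polynomial.aeval_C t c, hρ,
      Polynomial.map_X, Polynomial.map_C]
    exact ha'

omit [IsAlgClosed (ResidueField R)] in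
/-- **The rational points `𝔪·R[I/a] + (b/a − c)` are closed points** (maximal ideals), for every `c ∈ R` — generic-pair form of
`point_isMaximal` (p504673). [folklore] -/
theorem point_isMaximal_of_eq (I : Ideal R) (hI : I = Ideal.span {a, b}) (hb : b ∈ I)
    (ha : a ∈ maximalIdeal R) (hbm : b ∈ maximalIdeal R) (ha0 : a ≠ 0) (hab : ∀ x : R, a ∣ b * x → a ∣ x) (c : R) :
    ((maximalIdeal R).map (algebraMap R (blowupAlgebra I a)) ⊔
      Ideal.span {blowupAlgebra.gen I a b hb - algebraMap R (blowupAlgebra I a) c}).IsMaximal := by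
  set t := blowupAlgebra.gen I a b hb
  obtain ⟨ρ, hρ⟩ := exists_ringHom_polynomial_residueField I hI hb ha hbm ha0 hab
  have hρC : ∀ s : R, ρ (algebraMap R (blowupAlgebra I a) s) = C (residue R s) := fun s => by
    rw [← Polynomial.aeval_C t s, hρ, Polynomial.map_C]
  have hρt : ρ t = X := by rw [← Polynomial.aeval_X (R := R) t, hρ, Polynomial.map_X]
  rw [Ideal.isMaximal_iff]
  constructor
  · intro h1
    have h := Ideal.mem_map_of_mem ρ h1
    rw [Ideal.map_sup, Ideal.map_map, Ideal.map_span, Set.image_singleton, map_sub, hρt, hρC, map_one] at h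
    have hle : (maximalIdeal R).map (ρ.comp (algebraMap R (blowupAlgebra I a))) ⊔
        Ideal.span {X - C (residue R c)} ≤ Ideal.span {X - C (residue R c)} := by
      refine sup_le ?_ le_rfl
      rw [Ideal.map_le_iff_le_comap]
      intro m hm
      rw [Ideal.mem_comap, RingHom.comp_apply, hρC, (residue_eq_zero_iff m).mpr hm, map_zero]
      exact Ideal.zero_mem _
    have h1' := hle h
    rw [Ideal.mem_span_singleton] at h1'
    have hdeg := Polynomial.natDegree_le_of_dvd h1' one_ne_zero
    rw [natDegree_X_sub_C, natDegree_one] at hdeg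
    exact Nat.not_succ_le_zero 0 hdeg
  · intro K z hJK hzJ hzK
    obtain ⟨p, rfl⟩ := aeval_gen_surjective_of_eq I hI hb z
    obtain ⟨g, hg⟩ := Polynomial.X_sub_C_dvd_sub_C_eval (p := p) (a := c)
    have hdecomp : Polynomial.aeval t p = algebraMap R _ (p.eval c) + (t - algebraMap R _ c) * Polynomial.aeval t g := by
      have h := congrArg (Polynomial.aeval t) hg
      rw [map_sub, Polynomial.aeval_C, map_mul, map_sub, Polynomial.aeval_X, Polynomial.aeval_C] at h
      linear_combination h
    have htK : (t - algebraMap R _ c) * Polynomial.aeval t g ∈ K :=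
      hJK (Ideal.mem_sup_right (Ideal.mul_mem_right _ _ (Ideal.mem_span_singleton_self _)))
    have hp0 : p.eval c ∉ maximalIdeal R := by
      intro h0
      apply hzJ
      rw [hdecomp]
      exact Ideal.add_mem _ (Ideal.mem_sup_left (Ideal.mem_map_of_mem _ h0))
        (Ideal.mem_sup_right (Ideal.mul_mem_right _ _ (Ideal.mem_span_singleton_self _)))
    have hu : IsUnit (algebraMap R (blowupAlgebra I a) (p.eval c)) := by
      have : IsUnit (p.eval c) := by by_contra h; exact hp0 ((mem_maximalIdeal _).mpr h)
      exact this.map _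
    have hcK : algebraMap R (blowupAlgebra I a) (p.eval c) ∈ K := by
      have h := K.sub_mem hzK htK
      rwa [hdecomp, add_sub_cancel_right] at h
    exact K.eq_top_iff_one.mp (K.eq_top_of_isUnit_mem hcK hu)

end Chart

/-! ## Regularity descends to generizations -/

/-- **Localizations of a regular point are regular**: if `P ⊆ Q` are primes of `B` and `B_Q` is a regular local ring, then so is
`B_P` (Serre: `B_Q` is a regular ring, and `B_P = (B_Q)_{P B_Q}`). [folklore; Matsumura Thm. 19.3] -/
theorem isRegularLocalRing_localization_of_le {B : Type u} [CommRing B] (Q : Ideal B) [Q.IsPrime]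
    [hQ : IsRegularLocalRing (Localization.AtPrime Q)] (P : Ideal B) [P.IsPrime] (hPQ : P ≤ Q) :
    IsRegularLocalRing (Localization.AtPrime P) := by
  haveI : IsRegularRing (Localization.AtPrime Q) := isRegularRing_of_isRegularLocalRing _
  have hdisj : Disjoint (Q.primeCompl : Set B) P := Set.disjoint_left.mpr fun x hx hxP => hx (hPQ hxP)
  haveI hp : (P.map (algebraMap B (Localization.AtPrime Q))).IsPrime :=
    IsLocalization.isPrime_of_isPrime_disjoint Q.primeCompl _ P ‹_› hdisj
  have hunder : (P.map (algebraMap B (Localization.AtPrime Q))).comap (algebraMap B (Localization.AtPrime Q)) = P :=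
    IsLocalization.under_map_of_isPrime_disjoint Q.primeCompl (Localization.AtPrime Q) ‹_› hdisj
  have key : ∀ (P' : Ideal B) [P'.IsPrime],
      P' = (P.map (algebraMap B (Localization.AtPrime Q))).comap (algebraMap B (Localization.AtPrime Q)) →
      IsRegularLocalRing (Localization.AtPrime P') := by
    intro P' _ h
    subst h
    exact @IsRegularLocalRing.of_ringEquiv _ _ (inferInstance : IsRegularLocalRing
      (Localization.AtPrime (P.map (algebraMap B (Localization.AtPrime Q))))) _ _
      (IsLocalization.localizationLocalizationAtPrimeIsoLocalization Q.primeCompl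
        (P.map (algebraMap B (Localization.AtPrime Q)))).toRingEquiv.symm
  exact key P hunder.symm

/-! ## All primes of the two charts of `Bl_{V(e,w)}` over the closed point -/

section UniqueBadPointAll

variable {R : Type u} [CommRing R] [IsRegularLocalRing R] [IsAlgClosed (ResidueField R)] {e w : R}

/-- **`e`-chart, all primes: `B_𝔔` is regular iff `w/e ∉ 𝔔`** for every prime `𝔔 ⊇ 𝔪B` of `B = R[Z/e]` (`R` regular local with
algebraically closed residue field, `e ∈ 𝔪 ∖ 𝔪²`, `w ∈ 𝔪² ∖ (e)`): rational points by p504070, the generic point of the exceptional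
line by descent from the rational point `w/e = 1`. [folklore; CRUX-PLAN v1.1 §3.4 L2] -/
theorem isRegularLocalRing_localization_eChart_iff (he : e ∈ maximalIdeal R) (he₂ : e ∉ maximalIdeal R ^ 2)
    (hw : w ∈ maximalIdeal R ^ 2) (hwe : w ∉ Ideal.span {e})
    (𝔔 : Ideal (blowupAlgebra (Ideal.span {e, w}) e)) [𝔔.IsPrime]
    (hm : (maximalIdeal R).map (algebraMap R (blowupAlgebra (Ideal.span {e, w}) e)) ≤ 𝔔) :
    IsRegularLocalRing (Localization.AtPrime 𝔔) ↔
      blowupAlgebra.gen (Ideal.span {e, w}) e w (mem_span_pair_right e w) ∉ 𝔔 := by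
  haveI := isDomain_of_isRegularLocalRing R
  have hprime : Prime e := IsRegularLocalRing.prime_of_not_mem_sq he he₂
  have hw₁ : w ∈ maximalIdeal R := Ideal.pow_le_self two_ne_zero hw
  have hab : ∀ x : R, e ∣ w * x → e ∣ x := dvd_of_prime_dvd_mul_of_not_dvd hprime hwe
  constructor
  · intro hreg ht
    exact not_isRegularLocalRing_localization_badPoint he he₂ hw hwe 𝔔 hm ht hreg
  · intro ht
    rcases mem_or_eq_of_map_maximalIdeal_le (Ideal.span {e, w}) rfl (mem_span_pair_right e w) he hw₁ hprime.ne_zero hab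
        𝔔 hm with ⟨c, hc⟩ | hgen
    · -- a rational point `t = c̄`; `c` is a unit since `t ∉ 𝔔`
      have hcu : IsUnit c := by
        by_contra hcn
        apply ht
        have hcm : algebraMap R _ c ∈ 𝔔 := hm (Ideal.mem_map_of_mem _ ((mem_maximalIdeal _).mpr hcn))
        have h := 𝔔.add_mem hc hcm
        rwa [sub_add_cancel] at h
      exact isRegularLocalRing_localization_of_gen_sub_unit_mem he he₂ hw hwe c hcu 𝔔 hm hc
    · -- the generic point of the exceptional line: below the rational point `t = 1`
      haveI hP1 := point_isMaximal_of_eq (Ideal.span {e, w}) rfl (mem_span_pair_right e w) he hw₁ hprime.ne_zero hab 1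
      haveI : IsRegularLocalRing (Localization.AtPrime ((maximalIdeal R).map (algebraMap R (blowupAlgebra (Ideal.span {e, w}) e)) ⊔
          Ideal.span {blowupAlgebra.gen (Ideal.span {e, w}) e w (mem_span_pair_right e w) -
            algebraMap R (blowupAlgebra (Ideal.span {e, w}) e) 1})) :=
        isRegularLocalRing_localization_of_gen_sub_unit_mem he he₂ hw hwe 1 isUnit_one _ le_sup_left
          (Ideal.mem_sup_right (Ideal.mem_span_singleton_self _))
      have hle : 𝔔 ≤ (maximalIdeal R).map (algebraMap R (blowupAlgebra (Ideal.span {e, w}) e)) ⊔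
          Ideal.span {blowupAlgebra.gen (Ideal.span {e, w}) e w (mem_span_pair_right e w) -
            algebraMap R (blowupAlgebra (Ideal.span {e, w}) e) 1} := by
        rw [hgen]; exact le_sup_left
      exact isRegularLocalRing_localization_of_le _ 𝔔 hle

/-- **`w`-chart, all primes: `B′_𝔔` is regular** for every prime `𝔔 ⊇ 𝔪B′` of `B′ = R[Z/w]` (same hypotheses). [folklore;
CRUX-PLAN v1.1 §3.4 L2] -/
theorem isRegularLocalRing_localization_wChart' (he : e ∈ maximalIdeal R) (he₂ : e ∉ maximalIdeal R ^ 2)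
    (hw : w ∈ maximalIdeal R ^ 2) (hwe : w ∉ Ideal.span {e})
    (𝔔 : Ideal (blowupAlgebra (Ideal.span {e, w}) w)) [𝔔.IsPrime]
    (hm : (maximalIdeal R).map (algebraMap R (blowupAlgebra (Ideal.span {e, w}) w)) ≤ 𝔔) :
    IsRegularLocalRing (Localization.AtPrime 𝔔) := by
  haveI := isDomain_of_isRegularLocalRing R
  have hprime : Prime e := IsRegularLocalRing.prime_of_not_mem_sq he he₂
  have hw₁ : w ∈ maximalIdeal R := Ideal.pow_le_self two_ne_zero hw
  have hw0 : w ≠ 0 := by rintro rfl; exact hwe (Ideal.zero_mem _)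
  have hI : Ideal.span {e, w} = Ideal.span ({w, e} : Set R) := by rw [Set.pair_comm]
  have hab : ∀ x : R, w ∣ e * x → w ∣ x := dvd_of_dvd_prime_mul_of_not_dvd hprime hwe
  rcases mem_or_eq_of_map_maximalIdeal_le (Ideal.span {e, w}) hI (Ideal.subset_span (by simp)) hw₁ he hw0 hab 𝔔 hm with
      ⟨c, hc⟩ | hgen
  · exact isRegularLocalRing_localization_wChart he he₂ hw hwe c 𝔔 hm hc
  · haveI hP0 := point_isMaximal_of_eq (Ideal.span {e, w}) hI (Ideal.subset_span (by simp)) hw₁ he hw0 hab 0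
    haveI : IsRegularLocalRing (Localization.AtPrime ((maximalIdeal R).map (algebraMap R (blowupAlgebra (Ideal.span {e, w}) w)) ⊔
        Ideal.span {blowupAlgebra.gen (Ideal.span {e, w}) w e (Ideal.subset_span (by simp)) -
          algebraMap R (blowupAlgebra (Ideal.span {e, w}) w) 0})) :=
      isRegularLocalRing_localization_wChart he he₂ hw hwe 0 _ le_sup_left
        (Ideal.mem_sup_right (Ideal.mem_span_singleton_self _))
    have hle : 𝔔 ≤ (maximalIdeal R).map (algebraMap R (blowupAlgebra (Ideal.span {e, w}) w)) ⊔
        Ideal.span {blowupAlgebra.gen (Ideal.span {e, w}) w e (Ideal.subset_span (by simp)) -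
          algebraMap R (blowupAlgebra (Ideal.span {e, w}) w) 0} := by
      rw [hgen]; exact le_sup_left
    exact isRegularLocalRing_localization_of_le _ 𝔔 hle

end UniqueBadPointAll

end Summit.ResolutionOfSingularities.ResolutionOfSingularities.Cruxes.EquisingularLiftNat.Sections

end
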